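import Literature.NumberTheory.PAdicHodge.BmaxPlusPhiRoadReciprocity
import Literature.NumberTheory.PAdicHodge.BmaxPlusPhiRoadKummer
import Literature.NumberTheory.PAdicHodge.BmaxPlusPhiRoadThetaBOmega
import Literature.NumberTheory.PAdicHodge.KummerCocycleMatching
import Literature.NumberTheory.EllipticCurves.LocalTatePairingKummerTadic
import Literature.NumberTheory.EllipticCurves.TateModuleFreeProofs
import HarnessLib

/-!
# Kato's explicit reciprocity law at a completion for good supersingular `ℤ`-models and deep formal points — NO (K₂) hypothesis

Topic `Literature/NumberTheory/PAdicHodge`; THEOREMS ONLY (no definition, no named fact, no instance, no `sorry`). Sequel of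
`BmaxPlusPhiRoadReciprocity` (★★★ `exists_const_tatePairingPoint_eq_neg_trace_of_KTwo_phiRoad_of_matching`: the socket's capstone with the
φ-road's period maps along an abstract matching, modulo (K₂) in the φ-road's `c_L`-free form), memo
`Summits/BirchSwinnertonDyer/BirchSwinnertonDyer/Cruxes/StarredOptimalManinUnitFiveSeven/Lines/kato-lever-K2-tower-instantiation.md` §6–§7
(line `kato_lever`, crux K★ `stmt-BirchSwinnertonDyer-22226`). Here EVERYTHING the φ-road owes is discharged, for `E = Wℤ ⊗ F` (`Wℤ/ℤ` with good
supersingular reduction at `p ≥ 5`, `F = K_v`, `K₀ := F`):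

* §1 `em_phiRoad_canonical_smul` — equivariance of the CANONICAL matching `em = θ_∞ ≫ e` (`θ_∞ = tateModuleEquiv E F p`,
  `e = AinfTop.tateGeomEquivTatePtSS`: all torsion is formal at supersingular reduction); `em_tadicKummer_eq_kummerCocycle` — `em` carries the
  `T`-adic Kummer cocycle `κ_Q` of a division sequence `Q` (`LocalTatePairingKummerTadic`) to K1's `κ_u`, `uₙ = z(Qₙ)` (`tateGeomEquivTatePtSS_kummer`).
* §2 ★★★★ `exists_const_tatePairingPoint_eq_neg_trace_phiRoad_formalPoint` — ONE constant `c ∈ F` such that for every cocycle `η ∈ Z¹(Γ_F, T_pE)`,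
  every `P ∈ E(F)` whose image in `E(ℂ_F)` is a formal point with parameter `u₀ = z(P)` of norm `≤ ‖p‖`, and every `c_P ∈ F` with
  `ι(c_P) = p·log_ω(P)`: **`⟨[η], P⟩_{Tate} = −Tr_{F/ℚ_p}(c_P · exp*_d(η) · c)`** — Kato's formula, with NO matching, cocycle, integrating-pair or
  (K₂) hypothesis left: the integrating pair is the φ-road's `(f Λ_P, f φΛ_P)` (`phiRoad_integrating_pair`), `θ(f Λ_P) = p·log_ω(P)`
  (`thetaBdR_bmaxPlusToBdR_logSum_divisionLiftPt`), and (K₂) IS PROVED (`isTeichLog_phiRoad_resolution`, from the exact Dieudonné–Honda relation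
  `φ²Λ − a_pφΛ + pΛ = 0` and the fundamental-exact-sequence fragment). The remaining inputs are the cell data ONLY: the Weil tower `e` with
  `heL/healt/henondeg`, `ψ = log χ`, and the de Rham binders `hinj / hde / d` of the socket.

Other points of `E(F)` follow by the index step (`ReciprocityFormulaOffLevel`); the descent `K_v → ℚ_p` is `EllipticCurves/ReciprocityLawDescent`.
HONEST LIMITS: good supersingular `ℤ`-MODELS over the unramified-style base `𝒪_{ℂ_F}`-points of `Ŵℤ` (the K★ cells `W_min ⊗ ℚ_p(ϖ)`, `e ∈ {3,4,6}`, need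
the ramified transport — LEAD g26's ‹CM-fibre transport› or Breuil–Kisin); BSD / K★ (`stmt-BirchSwinnertonDyer-22226`) are NOT proved by this file.

## References
* K. Kato, LNM 1553 (1993), Ch. II Thm. 1.4.1, Lemma 1.4.3. [Kato1993LNM1553]
* S. Bloch, K. Kato (1990), Ex. 3.10.1, Example 3.11. [BlochKato1990]
* J. H. Silverman, *AEC* (2009), Prop. VII.2.1–VII.2.2, VIII §2. [SilvermanAEC2009]
-/

noncomputable section

open Field Function ValuativeRel WittVector NumberField IsDedekindDomain
open scoped NumberField Topology

namespace Literature.NumberTheory.PAdicHodge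

open Literature.NumberTheory.GaloisRepresentations
open Literature.NumberTheory.GaloisRepresentations.IsNonarchimedeanLocalField
open Literature.NumberTheory.GaloisRepresentations.LubinTate
open Literature.NumberTheory.GaloisCohomology
open Literature.NumberTheory.EllipticCurves
open Literature.NumberTheory.EllipticCurves.FormalGroupChart
open Literature.NumberTheory.PAdicHodge.GaloisContinuity
open Literature.IUT.LogVolume
open Literature.RingTheory.FormalGroups Literature.AlgebraicGeometry.Resolution
open _root_.WeierstrassCurve

section Completion

variable {K : Type} [Field K] [NumberField K] {p : ℕ} [hprime : Fact p.Prime] (v : HeightOneSpectrum (𝓞 K))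
  [CharZero (v.adicCompletion K)] [LocallyCompactSpace (absoluteGaloisGroup (v.adicCompletion K))]
  [Fact (¬ IsUnit (p : integerC (v.adicCompletion K)))]
  [IsAdicComplete (Ideal.span {(p : integerC (v.adicCompletion K))}) (integerC (v.adicCompletion K))]
  (hpv : valuation (v.adicCompletion K) (p : v.adicCompletion K) < 1)
  (Wℤ : WeierstrassCurve ℤ) (hp : ‖(p : CompletedAlgClosure (v.adicCompletion K))‖ < 1) (hp2 : p ≠ 2) (hΔ : ¬ (p : ℤ) ∣ Wℤ.Δ)
  (hA : (Wℤ.map (Int.castRingHom (ZMod p))).hasseCoeff p = 0)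
  [(AinfTop.curveF (v.adicCompletion K) Wℤ).IsElliptic]
  [(curveOver (CompletedAlgClosure (v.adicCompletion K)) Wℤ).IsElliptic]
  (e : (k : ℕ) → geomTorsion (AinfTop.curveF (v.adicCompletion K) Wℤ) ((p ^ k : ℕ) : ℤ) →
    geomTorsion (AinfTop.curveF (v.adicCompletion K) Wℤ) ((p ^ k : ℕ) : ℤ) → AlgebraicClosure (v.adicCompletion K))
  (hμ : ∀ k S T, e k S T ^ (p ^ k) = 1) (hadd₁ : ∀ k S₁ S₂ T, e k (S₁ + S₂) T = e k S₁ T * e k S₂ T)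
  (hadd₂ : ∀ k S T₁ T₂, e k S (T₁ + T₂) = e k S T₁ * e k S T₂)
  (hgal : ∀ k (σ : absoluteGaloisGroup (v.adicCompletion K))
    (S T : geomTorsion (AinfTop.curveF (v.adicCompletion K) Wℤ) ((p ^ k : ℕ) : ℤ)), σ • e k S T = e k (σ • S) (σ • T))
  (hcompat : ∀ k (S T : geomTorsion (AinfTop.curveF (v.adicCompletion K) Wℤ) ((p ^ (k + 1) : ℕ) : ℤ)),
    e k (torsionMulHom (AinfTop.curveF (v.adicCompletion K) Wℤ) (p ^ (k + 1)) (p ^ k) p (pow_succ p k).symm S)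
      (torsionMulHom (AinfTop.curveF (v.adicCompletion K) Wℤ) (p ^ (k + 1)) (p ^ k) p (pow_succ p k).symm T) = e (k + 1) S T ^ p)

/-! ### §1 The canonical matching and the `T`-adic Kummer cocycle -/

omit [LocallyCompactSpace (absoluteGaloisGroup (HeightOneSpectrum.adicCompletion K v))]
  [Fact (¬ IsUnit (p : integerC (v.adicCompletion K)))]
  [IsAdicComplete (Ideal.span {(p : integerC (v.adicCompletion K))}) (integerC (v.adicCompletion K))]
  [(curveOver (CompletedAlgClosure (v.adicCompletion K)) Wℤ).IsElliptic] in
/-- **Equivariance of the canonical matching** `em = θ_∞ ≫ e : T_pE|_{Γ_F} ⥲ T_pŴℤ(𝒪_ℂ)` (`E = Wℤ ⊗ F` over `K₀ := F`) along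
`absGaloisRestrict F F`: `tateModuleEquiv_smul` + `tateGeomEquivTatePtSS_galois`. [cite: SilvermanAEC2009, III §7] -/
theorem em_phiRoad_canonical_smul (σ : absoluteGaloisGroup (v.adicCompletion K))
    (a : (AinfTop.curveF (v.adicCompletion K) Wℤ).tateModule p) :
    ((tateModuleEquiv (AinfTop.curveF (v.adicCompletion K) Wℤ) (v.adicCompletion K) p).trans
        (AinfTop.tateGeomEquivTatePtSS (v.adicCompletion K) Wℤ p hp hp2 hΔ hA))
        (absGaloisRestrict (v.adicCompletion K) (v.adicCompletion K) σ • a) =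
      σ • ((tateModuleEquiv (AinfTop.curveF (v.adicCompletion K) Wℤ) (v.adicCompletion K) p).trans
        (AinfTop.tateGeomEquivTatePtSS (v.adicCompletion K) Wℤ p hp hp2 hΔ hA)) a := by
  rw [LinearEquiv.trans_apply, LinearEquiv.trans_apply, tateModuleEquiv_smul]
  exact AinfTop.tateGeomEquivTatePtSS_galois Wℤ p hp hp2 hΔ hA σ _

omit [LocallyCompactSpace (absoluteGaloisGroup (HeightOneSpectrum.adicCompletion K v))]
  [Fact (¬ IsUnit (p : integerC (v.adicCompletion K)))]
  [IsAdicComplete (Ideal.span {(p : integerC (v.adicCompletion K))}) (integerC (v.adicCompletion K))] in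
/-- **`em` carries the `T`-adic Kummer cocycle `κ_Q` to K1's `κ_u`** (`uₙ = z(Qₙ)`): `tateGeomEquivTatePtSS_kummer` read through `θ_∞⁻¹ ≫ θ_∞ = id`.
[cite: SilvermanAEC2009, Prop. VII.2.2 and VIII §2] [cite: BlochKato1990, Ex. 3.10.1] -/
theorem em_tadicKummer_eq_kummerCocycle
    {Q : ℕ → geomPoints ((AinfTop.curveF (v.adicCompletion K) Wℤ).baseChange (v.adicCompletion K))} (hQ : ∀ n, p • Q (n + 1) = Q n)
    (hfix : ∀ σ : absoluteGaloisGroup (v.adicCompletion K), σ • Q 0 = Q 0)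
    (hker : ∀ n, AinfTop.geomToC Wℤ (Q n) ∈ kernel (NormedField.valuation (K := CompletedAlgClosure (v.adicCompletion K)))
      (curveOver (CompletedAlgClosure (v.adicCompletion K)) Wℤ))
    (κ : contOneCocycles (restrictedTateRep (AinfTop.curveF (v.adicCompletion K) Wℤ) (v.adicCompletion K) p).toTopRep)
    (hκ : ∀ σ, κ.1 σ = (tateModuleEquiv (AinfTop.curveF (v.adicCompletion K) Wℤ) (v.adicCompletion K) p).symm
      (TateModule.mk (fun n => σ • Q n - Q n)
        (pow_smul_gal_sub_divSeq_eq_zero (AinfTop.curveF (v.adicCompletion K) Wℤ) (v.adicCompletion K) p hQ hfix σ)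
        (smul_gal_sub_divSeq_succ (AinfTop.curveF (v.adicCompletion K) Wℤ) (v.adicCompletion K) p hQ σ)))
    (τ : absoluteGaloisGroup (v.adicCompletion K)) :
    ((tateModuleEquiv (AinfTop.curveF (v.adicCompletion K) Wℤ) (v.adicCompletion K) p).trans
        (AinfTop.tateGeomEquivTatePtSS (v.adicCompletion K) Wℤ p hp hp2 hΔ hA)) (κ.1 τ) =
      AinfTop.kummerCocycle Wℤ (fun n => zPt (AinfTop.geomToC Wℤ (Q n)) (hker n)) (AinfTop.mulPC_zPt_divSeq Wℤ hQ hker)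
        (AinfTop.galCBall_zPt_divSeq_zero Wℤ hfix hker) τ := by
  rw [hκ, LinearEquiv.trans_apply, LinearEquiv.apply_symm_apply]
  exact AinfTop.tateGeomEquivTatePtSS_kummer Wℤ hp hp2 hΔ hA hQ hfix hker τ

/-! ### §2 Kato's formula for deep formal points of good supersingular `ℤ`-models: everything discharged -/

set_option maxHeartbeats 3200000 in
include hgal hp hp2 hΔ hA in
/-- ★★★★ **Kato's explicit reciprocity law at a completion for `E = Wℤ ⊗ K_v`, `Wℤ/ℤ` with good supersingular reduction at `p ≥ 5`, at DEEP FORMAL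
POINTS — no (K₂), no matching, no cocycle, no integrating-pair hypothesis.** Given the cell data (the Weil tower `e` with `heL/healt/henondeg`,
`ψ = log χ`, the de Rham binders `hinj / hde / d`), there is ONE `c ∈ F` such that for every `η ∈ Z¹(Γ_F, T_pE)`, every `P ∈ E(F)` with a `p`-power
division sequence `Q` (`Q₀ = P`; they exist, `LocalTatePairingKummerTadic.exists_divSeq`) whose base is a formal point with parameter of norm `≤ ‖p‖`,
and every `c_P ∈ F` with `ι(c_P) = p·log_ω(P)` (the classical `p`-adic elliptic logarithm of the image of `P` in `E₁(ℂ_F)`):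

  **`⟨[η], P⟩ = −Tr_{F/ℚ_p}(c_P · exp*_d(η) · c)`.**

Assembly: the φ-road's honest maps at index `1` (`exists_phiRoad_periodHoms`), the capstone along the canonical matching
(`exists_const_tatePairingPoint_eq_neg_trace_of_KTwo_phiRoad_of_matching` + §1), the `T`-adic Kummer cocycle and its level classes
(`LocalTatePairingKummerTadic`), the φ-road's integrating pair `(f Λ_P, f φΛ_P)` (`phiRoad_integrating_pair`), `θ(f Λ_P) = p·log_ω P`
(`thetaBdR_bmaxPlusToBdR_logSum_divisionLiftPt`), and (K₂) PROVED on a `ℤ_p`-basis of `T_pE` (`isTeichLog_phiRoad_resolution` with the Dieudonné–Honda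
relation `frobBmaxPlus_hondaTrace_logSum_divisionLiftPt_eq_zero`). [cite: Kato1993LNM1553, Ch. II Thm. 1.4.1 (3)–(4) and Lemma 1.4.3]
[cite: BlochKato1990, Ex. 3.10.1, Example 3.11] [cite: SilvermanAEC2009, Prop. VII.2.2 and VIII §2] -/
theorem exists_const_tatePairingPoint_eq_neg_trace_phiRoad_formalPoint (hp5 : 5 ≤ p)
    [(Wℤ.map (Int.castRingHom ℚ_[p])).IsElliptic] [(Wℤ.map (Int.castRingHom (ZMod p))).IsElliptic]
    (ψ : C(absoluteGaloisGroup (v.adicCompletion K), ℤ_[p])) (hψ : ∀ σ τ, ψ (σ * τ) = ψ σ + ψ τ)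
    (hψlog : ∀ τ, (ψ τ : ℚ_[p]) = logCyclotomic (F := (v.adicCompletion K)) p τ)
    (heL : ∀ (c : ℤ_[p]) (S U : (AinfTop.curveF (v.adicCompletion K) Wℤ).tateModule p),
      (weilContPairingPadic (AinfTop.curveF (v.adicCompletion K) Wℤ) (v.adicCompletion K) p e hμ hadd₁ hadd₂ hgal hcompat).toLin (c • S) U =
      twistHom (v.adicCompletion K) p
        ((weilContPairingPadic (AinfTop.curveF (v.adicCompletion K) Wℤ) (v.adicCompletion K) p e hμ hadd₁ hadd₂ hgal hcompat).toLin S U) c)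
    (healt : ∀ S : (AinfTop.curveF (v.adicCompletion K) Wℤ).tateModule p,
      (weilContPairingPadic (AinfTop.curveF (v.adicCompletion K) Wℤ) (v.adicCompletion K) p e hμ hadd₁ hadd₂ hgal hcompat).toLin S S = 0)
    (henondeg : ∀ S : (AinfTop.curveF (v.adicCompletion K) Wℤ).tateModule p,
      (∀ U, (weilContPairingPadic (AinfTop.curveF (v.adicCompletion K) Wℤ) (v.adicCompletion K) p e hμ hadd₁ hadd₂ hgal hcompat).toLin S U = 0) →
        S = 0)
    (hinj : letI := LocalField.padicAlgebra (v.adicCompletion K) p hpv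
      (bdRPeriodRingData (F := (v.adicCompletion K)) (p := p) hpv).CupLogInjective (logCyclotomic p)
        (restrictedRationalTateRep (AinfTop.curveF (v.adicCompletion K) Wℤ) (v.adicCompletion K) p))
    (hde : letI := LocalField.padicAlgebra (v.adicCompletion K) p hpv
      ∀ η : contOneCocycles (restrictedTateRep (AinfTop.curveF (v.adicCompletion K) Wℤ) (v.adicCompletion K) p).toTopRep,
        (bdRPeriodRingData (F := (v.adicCompletion K)) (p := p) hpv).HasDualExp (logCyclotomic p)
          (restrictedRationalTateRep (AinfTop.curveF (v.adicCompletion K) Wℤ) (v.adicCompletion K) p)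
          fun σ => TateModule.toRational p (η.1 σ))
    (d : letI := LocalField.padicAlgebra (v.adicCompletion K) p hpv
      (bdRPeriodRingData (F := (v.adicCompletion K)) (p := p) hpv).FilZeroLine
        (restrictedRationalTateRep (AinfTop.curveF (v.adicCompletion K) Wℤ) (v.adicCompletion K) p)) :
    letI := LocalField.padicAlgebra (v.adicCompletion K) p hpv
    ∃ c : v.adicCompletion K,
      ∀ (η : contOneCocycles (restrictedTateRep (AinfTop.curveF (v.adicCompletion K) Wℤ) (v.adicCompletion K) p).toTopRep)
        (P : ((AinfTop.curveF (v.adicCompletion K) Wℤ).baseChange (v.adicCompletion K)).toAffine.Point)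
        (Q : ℕ → geomPoints ((AinfTop.curveF (v.adicCompletion K) Wℤ).baseChange (v.adicCompletion K))) (hQ : ∀ n, p • Q (n + 1) = Q n)
        (_hQ0 : Q 0 = toGeomPoints ((AinfTop.curveF (v.adicCompletion K) Wℤ).baseChange (v.adicCompletion K)) P)
        (hP1 : AinfTop.geomToC Wℤ (Q 0) ∈ kernel (NormedField.valuation (K := CompletedAlgClosure (v.adicCompletion K)))
          (curveOver (CompletedAlgClosure (v.adicCompletion K)) Wℤ)),
        ‖((zPt (AinfTop.geomToC Wℤ (Q 0)) hP1 : CBall (v.adicCompletion K)) : CompletedAlgClosure (v.adicCompletion K))‖ ≤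
            ‖(p : CompletedAlgClosure (v.adicCompletion K))‖ →
        ∀ cP : v.adicCompletion K,
          algebraMap (v.adicCompletion K) (CompletedAlgClosure (v.adicCompletion K)) cP =
            (p : CompletedAlgClosure (v.adicCompletion K)) *
              padicLogPointFiniteExt (NormedField.valuation (K := CompletedAlgClosure (v.adicCompletion K)))
                (curveOver (CompletedAlgClosure (v.adicCompletion K)) Wℤ) p
                (ptOfZ (CompletedAlgClosure (v.adicCompletion K)) Wℤ (zPt (AinfTop.geomToC Wℤ (Q 0)) hP1)) →
          ((tatePairingPoint (AinfTop.curveF (v.adicCompletion K) Wℤ) (v.adicCompletion K) p e hμ hadd₁ hadd₂ hgal hcompat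
              (oneCocycleClass _ η) P : ℤ_[p]) : ℚ_[p]) =
            -Algebra.trace ℚ_[p] (v.adicCompletion K) (cP * (expStarCoord (AinfTop.curveF (v.adicCompletion K) Wℤ) hpv d η * c)) := by
  sorry

end Completion

end Literature.NumberTheory.PAdicHodge

end
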